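import Summits.AtomisticToContinuum.Crystallization.Theorems.ChargedEnergyGapBarlowResidual
import HarnessLib

/-!
# Charged energy gap — lens-3 g64, node «BarlowRef» (R3) — part 3 (addendum): counting tools for the tube-load lemma P-Z₅c′

Sequel of `…Theorems.ChargedEnergyGapBarlowResidual` (parts 1–2: the (R3) pair, cones, residual `BulkFarResidueBoundB`, witness, `TubeLoad`,
shadow lemmas).  This addendum supplies the two ELEMENTARY·PROVED counting inputs the counting half of P-Z₅c′ consumes, and TYPES its lattice input:

* §R8 ★ `card_mul_le_of_separated_annulus` — SHARP VOLUME PACKING IN AN ANNULUS: an `s`-separated finite set with all points at distance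
  `∈ [R, R + t]` from `x` (`s/2 ≤ R`) satisfies `#T · (s/2)³ + (R − s/2)³ ≤ (R + t + s/2)³` (the `s/2`-balls are disjoint, inside the closed
  `(R + t + s/2)`-ball and outside the open `(R − s/2)`-ball).  Per unit shell this is `≈ 24 R²/s³ · (t + s)` against the truth `4πρR²t`: at the
  Barlow window separation and `t = 5` the loss is `≈ ×1.7` — versus `×190` for the tree's dyadic tail lemma
  `ExcessDecayLiouvilleFarField.sum_inv_pow_le_of_separated` (constant `1024/(δ³R³)`), which is why the tube-load lemma cannot simply cite it.
  Corollaries for `IsSeparatedRef` references (`IsSeparatedRef.ncard_annulus_le`).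
* §R9 ★ `inner_ge_of_dist_le_of_le_dist` — THE SOURCE HALF-SPACE: if `dist x c ≤ a` and `ϱ ≤ dist x c₀` then
  `⟪x − c, c − c₀⟫ ≥ (ϱ² − dist c c₀² − a²)/2`.  With `c₀ ∈ C` a nearest centre to a carrier `c` at level `λ_c = dist c c₀ < ϱ = 160` and `x = y` a
  bulk source (`infDist y C ≥ 160`), the sources within `a` of the carrier lie in the half-space `⟪y − c, u⟫ ≥ (160² − λ_c² − a²)/(2λ_c)`
  (`u = (c − c₀)/λ_c`) — for `λ_c = 159`, `a ≤ 20`: `⟪y − c, u⟫ ≥ −0.26`, i.e. (almost) the upper half-ball only: the certified form of the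
  «adjacent sources fill at most a half-space» remark of memo g64 §1 (B), halving the worst column of the feasibility table.
* §R10 TYPED LATTICE INPUT `BarlowBallCount R N : Prop` — every Barlow image has at least `N` sites within `R` of each of its sites (to be
  proved for the block radii by index boxes over `barlowPos`, as `…SecondShell.exists_finset_card_109` does at radius 3; the volume-covering
  argument with the covering radius `81/100` loses `×4.8` and is NOT sufficient) — with its monotonicity; the record arithmetic of the block
  count the scheme needs (`barlowBallCount_target`); and ★ `TubeShareBound s r a₀ b₀ R θ` — THE RATIO FORM `tubeLoad ≤ θ · #(block)` that P-Z₅d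
  consumes and the recommended prover target (load `∝ ρ²` and count `∝ ρ` refer to the same density of the ONE stacking, so the ratio is worst
  at the dense corner only; the product route `tubeShareBound_of_loadBound` through `TubeLoadBound ∧ BarlowBallCount` loses `≈ ×2.2`).

0 sorry; standard axioms; no new `EQUIV`; nothing here is a piece of the cone — tools and a typed input for the prover of P-Z₅c′.
-/

noncomputable section

open scoped Classical
open MeasureTheory
open Literature.MathematicalPhysics.StatisticalMechanics Literature.Geometry.DiscreteGeometry
open Summit.AtomisticToContinuum.Crystallization.Theses.PricedLinkCensus
open Summit.AtomisticToContinuum.Crystallization.Theorems.ChargedEnergyGapNegative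

namespace Summit.AtomisticToContinuum.Crystallization.Theorems.ChargedEnergyGapChartDial

/-! ## §R8 ★ Sharp volume packing in an annulus -/
section Annulus

/-- ★ **ANNULUS PACKING COUNT**: a finite `s`-separated set of points of `E3` all at distance `∈ [R, R + t]` from `x`, with `s/2 ≤ R`, satisfies
`#T · (s/2)³ + (R − s/2)³ ≤ (R + t + s/2)³`. -/
theorem card_mul_le_of_separated_annulus (T : Finset E3) {s R t : ℝ} (hs : 0 < s) (hR : s / 2 ≤ R) (ht : 0 ≤ t) (x : E3)
    (hsep : ∀ p ∈ T, ∀ q ∈ T, p ≠ q → s ≤ dist p q) (hT : ∀ p ∈ T, R ≤ dist p x ∧ dist p x ≤ R + t) :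
    (T.card : ℝ) * (s / 2) ^ 3 + (R - s / 2) ^ 3 ≤ (R + t + s / 2) ^ 3 := by
  have hs2 : (0 : ℝ) ≤ s / 2 := by linarith
  have hRs : (0 : ℝ) ≤ R - s / 2 := by linarith
  have hRt : (0 : ℝ) ≤ R + t + s / 2 := by linarith
  -- the small balls are pairwise disjoint
  have hPD : (↑T : Set E3).PairwiseDisjoint fun p => Metric.ball p (s / 2) := by
    intro p hp q hq hpq
    exact Metric.ball_disjoint_ball (by linarith [hsep p hp q hq hpq])
  -- contained in the big closed ball
  have hcov : (⋃ p ∈ T, Metric.ball p (s / 2)) ⊆ Metric.closedBall x (R + t + s / 2) := by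
    intro z hz
    rw [Set.mem_iUnion₂] at hz
    obtain ⟨p, hp, hz⟩ := hz
    rw [Metric.mem_ball] at hz
    rw [Metric.mem_closedBall]
    linarith [dist_triangle z p x, (hT p hp).2]
  -- and disjoint from the small inner ball
  have hdisj : Disjoint (⋃ p ∈ T, Metric.ball p (s / 2)) (Metric.ball x (R - s / 2)) := by
    rw [Set.disjoint_left]
    intro z hz hz'
    rw [Set.mem_iUnion₂] at hz
    obtain ⟨p, hp, hz⟩ := hz
    rw [Metric.mem_ball] at hz hz'
    linarith [dist_triangle p z x, dist_comm p z, (hT p hp).1]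
  have hin : Metric.ball x (R - s / 2) ⊆ Metric.closedBall x (R + t + s / 2) :=
    Metric.ball_subset_closedBall.trans (Metric.closedBall_subset_closedBall (by linarith))
  have hvolU : volume (⋃ p ∈ T, Metric.ball p (s / 2)) = ∑ p ∈ T, volume (Metric.ball p (s / 2)) :=
    measure_biUnion_finset hPD fun p _ => measurableSet_ball
  have key : volume (⋃ p ∈ T, Metric.ball p (s / 2)) + volume (Metric.ball x (R - s / 2)) ≤
      volume (Metric.closedBall x (R + t + s / 2)) := by
    rw [← measure_union hdisj measurableSet_ball]
    exact measure_mono (Set.union_subset hcov hin)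
  rw [hvolU, Finset.sum_congr rfl (fun p _ => Measure.addHaar_ball volume p hs2), Finset.sum_const, nsmul_eq_mul,
    Measure.addHaar_ball volume x hRs, Measure.addHaar_closedBall volume x hRt, finrank_euclideanSpace_fin, ← mul_assoc, ← add_mul] at key
  have hV0 : volume (Metric.ball (0 : E3) 1) ≠ 0 := (Metric.measure_ball_pos volume (0 : E3) one_pos).ne'
  have hVt : volume (Metric.ball (0 : E3) 1) ≠ ⊤ := measure_ball_lt_top.ne
  have key' : (T.card : ENNReal) * ENNReal.ofReal ((s / 2) ^ 3) + ENNReal.ofReal ((R - s / 2) ^ 3) ≤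
      ENNReal.ofReal ((R + t + s / 2) ^ 3) :=
    (ENNReal.mul_le_mul_iff_left hV0 hVt).1 key
  rw [← ENNReal.ofReal_natCast, ← ENNReal.ofReal_mul (Nat.cast_nonneg _), ← ENNReal.ofReal_add (by positivity) (by positivity),
    ENNReal.ofReal_le_ofReal_iff (by positivity)] at key'
  exact key'

/-- The count form: `#T ≤ ((R + t + s/2)³ − (R − s/2)³)/(s/2)³`. -/
theorem card_le_of_separated_annulus (T : Finset E3) {s R t : ℝ} (hs : 0 < s) (hR : s / 2 ≤ R) (ht : 0 ≤ t) (x : E3)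
    (hsep : ∀ p ∈ T, ∀ q ∈ T, p ≠ q → s ≤ dist p q) (hT : ∀ p ∈ T, R ≤ dist p x ∧ dist p x ≤ R + t) :
    (T.card : ℝ) ≤ ((R + t + s / 2) ^ 3 - (R - s / 2) ^ 3) / (s / 2) ^ 3 := by
  have h := card_mul_le_of_separated_annulus T hs hR ht x hsep hT
  rw [le_div_iff₀ (by positivity)]
  linarith

variable {s : ℝ} {P : PeriodicConfiguration 3}

/-- ★ For an `s`-separated reference: the sites at distance `∈ [R, R + t]` from any point number at most
`((R + t + s/2)³ − (R − s/2)³)/(s/2)³` (finite by `IsSeparatedRef.finite_inter_closedBall`). -/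
theorem IsSeparatedRef.ncard_annulus_le (hP : IsSeparatedRef s P) (hs : 0 < s) {R t : ℝ} (hR : s / 2 ≤ R) (ht : 0 ≤ t) (x : E3) :
    ((P.points ∩ {p | R ≤ dist p x ∧ dist p x ≤ R + t}).ncard : ℝ) ≤ ((R + t + s / 2) ^ 3 - (R - s / 2) ^ 3) / (s / 2) ^ 3 := by
  have hsub : P.points ∩ {p | R ≤ dist p x ∧ dist p x ≤ R + t} ⊆ P.points ∩ Metric.closedBall x (R + t) :=
    fun p hp => ⟨hp.1, Metric.mem_closedBall.2 hp.2.2⟩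
  have hF := (hP.finite_inter_closedBall hs x (R + t)).subset hsub
  rw [Set.ncard_eq_toFinset_card _ hF]
  refine card_le_of_separated_annulus hF.toFinset hs hR ht x (fun p hp q hq hpq => ?_) (fun p hp => ?_)
  · rw [Set.Finite.mem_toFinset] at hp hq
    exact hP p hp.1 q hq.1 hpq
  · rw [Set.Finite.mem_toFinset] at hp
    exact hp.2

/-- The Finset form (a finite family of reference sites in the annulus). -/
theorem IsSeparatedRef.card_annulus_le (hP : IsSeparatedRef s P) (hs : 0 < s) {R t : ℝ} (hR : s / 2 ≤ R) (ht : 0 ≤ t) (x : E3)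
    (T : Finset E3) (hT : ∀ p ∈ T, p ∈ P.points ∧ R ≤ dist p x ∧ dist p x ≤ R + t) :
    (T.card : ℝ) ≤ ((R + t + s / 2) ^ 3 - (R - s / 2) ^ 3) / (s / 2) ^ 3 :=
  card_le_of_separated_annulus T hs hR ht x (fun p hp q hq hpq => hP p (hT p hp).1 q (hT q hq).1 hpq) fun p hp => (hT p hp).2

/-- RECORD ARITHMETIC (the target shell of the scheme): at the Barlow-window separation floor `s = 1/2` (`IsBarlowImage.le_dist`) resp. the
sharper `21/25`, a shell `[60, 65]` holds at most `64·(65.25³ − 59.75³) = 4 127 662` resp. `(65.42³ − 59.58³)/0.42³ < 924 405` sites —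
against the truth `4π·2.16·62.5²·5 ≈ 5.3·10⁵`: losses `×7.8` resp. `×1.74` (so the sharp window separation `21/25` is worth proving;
`IsBarlowImage.le_dist` gives only `1/2`). -/
theorem record_shell_count_arith :
    ((60 + 5 + (1 / 2 : ℝ) / 2) ^ 3 - (60 - (1 / 2 : ℝ) / 2) ^ 3) / ((1 / 2 : ℝ) / 2) ^ 3 = 4127662 ∧
    ((60 + 5 + (21 / 25 : ℝ) / 2) ^ 3 - (60 - (21 / 25 : ℝ) / 2) ^ 3) / ((21 / 25 : ℝ) / 2) ^ 3 < 924405 := by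
  constructor <;> norm_num

end Annulus

/-! ## §R9 ★ The source half-space -/
section HalfSpace

/-- ★ **SOURCE HALF-SPACE**: if `dist x c ≤ a` and `ϱ ≤ dist x c₀` (`0 ≤ ϱ`), then `⟪x − c, c − c₀⟫ ≥ (ϱ² − dist c c₀² − a²)/2`.
(Expand `‖x − c₀‖² = ‖x − c‖² + 2⟪x − c, c − c₀⟫ + ‖c − c₀‖²`.)  Bulk sources near a carrier at level `< ϱ` fill a half-ball, not a ball. -/
theorem inner_ge_of_dist_le_of_le_dist {x c c₀ : E3} {a ϱ : ℝ} (hϱ : 0 ≤ ϱ) (hx : dist x c ≤ a) (hxo : ϱ ≤ dist x c₀) :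
    (ϱ ^ 2 - dist c c₀ ^ 2 - a ^ 2) / 2 ≤ inner ℝ (x - c) (c - c₀) := by
  have hsq : ‖x - c₀‖ ^ 2 = ‖x - c‖ ^ 2 + 2 * inner ℝ (x - c) (c - c₀) + ‖c - c₀‖ ^ 2 := by
    rw [← norm_add_sq_real, sub_add_sub_cancel]
  rw [← dist_eq_norm, ← dist_eq_norm, ← dist_eq_norm] at hsq
  have h1 : ϱ ^ 2 ≤ dist x c₀ ^ 2 := pow_le_pow_left₀ hϱ hxo 2
  have h2 : dist x c ^ 2 ≤ a ^ 2 := pow_le_pow_left₀ dist_nonneg hx 2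
  linarith

/-- The level form: for a bulk source `y` (`ϱ ≤ infDist y C`), a centre `c₀ ∈ C` and a carrier `c` with `dist y c ≤ a`:
`⟪y − c, c − c₀⟫ ≥ (ϱ² − dist c c₀² − a²)/2`. -/
theorem inner_ge_of_bulk_source {C : Set E3} {y c c₀ : E3} {a ϱ : ℝ} (hϱ : 0 ≤ ϱ) (hc₀ : c₀ ∈ C) (hy : ϱ ≤ Metric.infDist y C)
    (hyc : dist y c ≤ a) : (ϱ ^ 2 - dist c c₀ ^ 2 - a ^ 2) / 2 ≤ inner ℝ (y - c) (c - c₀) :=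
  inner_ge_of_dist_le_of_le_dist hϱ hyc (hy.trans (Metric.infDist_le_dist_of_mem hc₀))

/-- RECORD ARITHMETIC: at `ϱ = 160`, carrier level `dist c c₀ ≤ 159` and source radius `a ≤ 20` the bound reads `⟪y − c, c − c₀⟫ ≥ −81/2`,
i.e. `⟪y − c, u⟫ ≥ −81/318 > −0.26` for the unit vector `u = (c − c₀)/159`. -/
theorem record_halfspace_arith : ((160 : ℝ) ^ 2 - 159 ^ 2 - 20 ^ 2) / 2 = -81 / 2 ∧ (-81 / 2 : ℝ) / 159 > -26 / 100 := by
  constructor <;> norm_num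

end HalfSpace

/-! ## §R10 Typed lattice input: the Barlow ball count -/
section BallCount

/-- **BARLOW BALL COUNT** (typed input of the block certification, P-Z₅d): every Barlow image has at least `N` sites within distance `R` of each of
its sites, exhibited as a finite sub-family.  To be PROVED for the block radii by index boxes over `barlowPos` (exact lattice counting); the truth is
`≈ 0.966·(4π/3)(R − 3/4)³ ≥ N` uniformly over the window (densities `2.06–2.16`). -/
def BarlowBallCount (R : ℝ) (N : ℕ) : Prop :=
  ∀ S : Set E3, IsBarlowImage S → ∀ q ∈ S, ∃ T : Finset E3, ↑T ⊆ S ∩ Metric.closedBall q R ∧ N ≤ T.card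

/-- Monotone in the radius, antitone in the count. [formal bookkeeping] -/
theorem BarlowBallCount.mono {R R' : ℝ} {N N' : ℕ} (hR : R ≤ R') (hN : N' ≤ N) (h : BarlowBallCount R N) : BarlowBallCount R' N' :=
  fun S hS q hq => by
    obtain ⟨T, hT, hc⟩ := h S hS q hq
    exact ⟨T, hT.trans (Set.inter_subset_inter_right _ (Metric.closedBall_subset_closedBall hR)), hN.trans hc⟩

/-- The trivial instance (the site itself): `BarlowBallCount R 1` for `0 ≤ R`. -/
theorem barlowBallCount_one {R : ℝ} (hR : 0 ≤ R) : BarlowBallCount R 1 := fun S _ q hq =>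
  ⟨{q}, by simpa using ⟨hq, hR⟩, by simp⟩

/-- RECORD ARITHMETIC (memo g64 §1 (B), the block counts the scheme divides by): `0.966·(4π/3)(R − 3/4)³` exceeds `20 000` at `R = 18`,
`24 000` at `R = 19` and `100 000` at `R = 30` already with `π > 3.14159`; the typed targets for the prover are therefore
`BarlowBallCount 18 20000`, `BarlowBallCount 19 24000`, `BarlowBallCount 30 100000` (index-box counts reach `≈ 0.9` of these; see memo §3). -/
theorem barlowBallCount_target :
    (20000 : ℝ) < 966 / 1000 * (4 * 314159 / 100000 / 3) * (18 - 3 / 4) ^ 3 ∧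
    (24000 : ℝ) < 966 / 1000 * (4 * 314159 / 100000 / 3) * (19 - 3 / 4) ^ 3 ∧
    (100000 : ℝ) < 966 / 1000 * (4 * 314159 / 100000 / 3) * (30 - 3 / 4) ^ 3 := by
  refine ⟨?_, ?_, ?_⟩ <;> norm_num

/-- **TUBE SHARE BOUND** — THE RATIO FORM the block accounting (P-Z₅d) actually consumes, and the recommended prover target for P-Z₅c′:
over separated Barlow-image references, the pass-load at a carrier `c` is at most `θ` times the site count of a block `closedBall q R` about a
reference site `q`.  WHY THE RATIO: a Barlow image has ONE spacing pair `(a, h)`, so load (`∝ ρ²`) and block count (`∝ ρ`) refer to the SAME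
density `ρ ∈ [0.966, 2.16]` and `θ_needed ∝ ρ`; proving `TubeLoadBound … K` (worst at the dense corner) and `BarlowBallCount R N` (worst at the
sparse corner) separately and dividing loses the factor `2.16/0.966 ≈ 2.2` (`tubeShareBound_of_loadBound` below is that lossy route). -/
def TubeShareBound (s r a₀ b₀ R θ : ℝ) : Prop :=
  ∀ P : PeriodicConfiguration 3, IsSeparatedRef s P → IsBarlowImage P.points →
    ∀ (c q : E3) (F G : Finset E3), (↑F : Set E3) ⊆ P.points → (↑G : Set E3) ⊆ P.points → q ∈ P.points →
      (∀ y ∈ F, a₀ ≤ dist y c) → (∀ z ∈ G, b₀ ≤ dist z c) →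
      tubeLoad r c F G ≤ θ * ((P.points ∩ Metric.closedBall q R).ncard : ℝ)

/-- The lossy product route: a load bound `K`, a ball count `N` and `K ≤ θ N` (`0 ≤ θ`, `0 < s`) give the share bound `θ`. -/
theorem tubeShareBound_of_loadBound {s r a₀ b₀ R θ K : ℝ} {N : ℕ} (hs : 0 < s) (hθ : 0 ≤ θ) (hK : K ≤ θ * N)
    (hL : TubeLoadBound s r a₀ b₀ K) (hN : BarlowBallCount R N) : TubeShareBound s r a₀ b₀ R θ := by
  intro P hsep hB c q F G hF hG hq hFa hGb
  obtain ⟨T, hT, hcard⟩ := hN P.points hB q hq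
  have hfin : (P.points ∩ Metric.closedBall q R).Finite := hsep.finite_inter_closedBall hs q R
  have hle : (N : ℝ) ≤ ((P.points ∩ Metric.closedBall q R).ncard : ℝ) := by
    have h1 : T.card ≤ (P.points ∩ Metric.closedBall q R).ncard := by
      rw [← Set.ncard_coe_finset]; exact Set.ncard_le_ncard hT hfin
    exact_mod_cast hcard.trans h1
  calc tubeLoad r c F G ≤ K := hL P hsep hB c F G hF hG hFa hGb
    _ ≤ θ * N := hK
    _ ≤ θ * ((P.points ∩ Metric.closedBall q R).ncard : ℝ) := mul_le_mul_of_nonneg_left hle hθ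

/-- Monotonicity of the share bound (radius of the tube down, exclusion radii up, block radius up, constant up). [formal bookkeeping] -/
theorem TubeShareBound.mono {s r a₀ b₀ R θ r' a₀' b₀' R' θ' : ℝ} (hs : 0 < s) (hr : r' ≤ r) (ha : a₀ ≤ a₀') (hb : b₀ ≤ b₀') (hR : R ≤ R')
    (hθ : θ ≤ θ') (hθ0 : 0 ≤ θ) (h : TubeShareBound s r a₀ b₀ R θ) : TubeShareBound s r' a₀' b₀' R' θ' := by
  intro P hsep hB c q F G hF hG hq hFa hGb
  have hfin : (P.points ∩ Metric.closedBall q R').Finite := hsep.finite_inter_closedBall hs q R'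
  have hcnt : ((P.points ∩ Metric.closedBall q R).ncard : ℝ) ≤ ((P.points ∩ Metric.closedBall q R').ncard : ℝ) := by
    exact_mod_cast Set.ncard_le_ncard (Set.inter_subset_inter_right _ (Metric.closedBall_subset_closedBall hR)) hfin
  calc tubeLoad r' c F G ≤ tubeLoad r c F G := tubeLoad_mono hr c F G
    _ ≤ θ * ((P.points ∩ Metric.closedBall q R).ncard : ℝ) :=
        h P hsep hB c q F G hF hG hq (fun y hy => ha.trans (hFa y hy)) fun z hz => hb.trans (hGb z hz)
    _ ≤ θ' * ((P.points ∩ Metric.closedBall q R').ncard : ℝ) :=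
        (mul_le_mul_of_nonneg_left hcnt hθ0).trans (mul_le_mul_of_nonneg_right hθ (Nat.cast_nonneg _))

end BallCount

end Summit.AtomisticToContinuum.Crystallization.Theorems.ChargedEnergyGapChartDial

end
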